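import Summits.ABC.ABC.Theorems.LogCardinalitySubPowerStewartYuInflation
import Summits.ABC.ABC.Theorems.LogCardinalitySubPowerStewartYuParams
import HarnessLib

/-!
# Sub-power Stewart–Yu (crux `SubPowerStewartYu`, stmt-ABC-11053), VI: the bound at the top prime

`Summits/ABC/ABC/Theorems/LogCardinalitySubPowerStewartYuTop.lean` — sixth helper file toward
`Summit.ABC.ABC.Theses.LogCardinality.SubPowerStewartYu`.

* `inflation_at_top` — the bound at a (top) prime `p ∤ uv` supplied by Stewart's inflation of the
  inlined Yu clause [cite: Stewart2013, Lemma 8 (arXiv pp. 9–10)]: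
  `ord_p((u/v)² − 1) · log p ≤ (∏_{q∣uv} log q) · log max{e, 2y} · 3 p e^{−3k}` under the numeric
  side conditions of `numeric_core` (`k − 1` auxiliary primes of logarithmic size `≤ m`,
  `ω(uv) ≤ k + 1`, `log(uv) ≤ 2y`);
* `top_prime_bound` — the same with Stewart's choice `k = ⌊log p/(C₂ log log p)⌋`,
  `C₂ = 64 Ā² e⁴`, the auxiliary primes taken among the first `k + ω(uv) + 1` primes (Chebyshev),
  and all side conditions discharged from largeness hypotheses on `L = log R` (`L/4 ≤ log p ≤ L`):
  the output is `X = p e^{−3k}` with `D² e^{6c₁L/log L} ≤ X ≤ p e³ e^{−3L/(4C₂ log L)}`.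
No new definitions.
-/

noncomputable section

-- `Summit.ABC.ABC.…` is the tree's namespace convention for this sub-problem (summit = problem).
set_option linter.dupNamespace false

open Finset Real Height
open Literature.NumberTheory.DiophantineGeometry
open Literature.NumberTheory.DiophantineGeometry.Dioph
open Literature.NumberTheory.DiophantineGeometry.Pasten
open Literature.Barriers.ABC

namespace Summit.ABC.ABC.Theorems.SubPowerSY

/-! ### The bound at the top prime from the inflated Yu clause -/

section Top

variable {A : ℝ}

/-- **The bound at a top prime from Stewart's inflation of the inlined Yu clause.** For coprime
positive `u, v` with `uv > 1` and `log(uv) ≤ 2y` (`y ≥ 0`), a prime `p ∤ uv` with `p ≥ 5`, a set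
`P` of `j = k − 1 ≥ 1` auxiliary primes (`r ∤ uv`, `r ≠ p`, `log r ≤ m`, `m ≥ 1`), `ω(uv) ≤ k + 1`,
and the absorptions of `numeric_core` at `L = log p`:
`ord_p((u/v)² − 1) · log p ≤ (∏_{q ∣ uv} log q) · log max{e, 2y} · 3 p e^{−3k}`.
[cite: Stewart2013, Lemma 8 (arXiv pp. 9–10)] -/
theorem inflation_at_top
    (hYu : ∀ (n p : ℕ) (α : Fin n → ℚ) (b : Fin n → ℤ), 1 ≤ n → p.Prime → 5 ≤ p →
      (∀ i, α i ≠ 0 ∧ padicValRat p (α i) = 0) → (∀ e : Fin n → ℤ, ∏ i, α i ^ e i = 1 → e = 0) →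
      b ≠ 0 → (padicValRat p (∏ i, α i ^ b i - 1) : ℝ) ≤
        A ^ n * max ((p : ℝ) * ((n : ℝ) / Real.log p) ^ n) (Real.exp n * Real.log p) *
          (∏ i, max 1 (logHeight₁ (α i))) * max (Real.log (2 + ∑ i, |(b i : ℝ)|)) ((n : ℝ) ^ 2))
    {u v : ℕ} (hu : 0 < u) (hv : 0 < v) (huv : u.Coprime v) (h1 : 1 < u * v)
    {y : ℝ} (hy : 0 ≤ y) (huvy : Real.log ((u * v : ℕ) : ℝ) ≤ 2 * y)
    {p : ℕ} (hp : p.Prime) (hp5 : 5 ≤ p) (hpuv : ¬ p ∣ u * v)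
    {P : Finset ℕ} (hP : ∀ r ∈ P, r.Prime ∧ ¬ r ∣ u * v ∧ r ≠ p) {j : ℕ} (hPj : P.card = j)
    (hj : 1 ≤ j) {m : ℝ} (hm : 1 ≤ m) (hPm : ∀ r ∈ P, Real.log r ≤ m)
    (hn : (u * v).primeFactors.card ≤ j + 2) (hkL : 2 * ((j : ℝ) + 1) ≤ Real.log p)
    (hi : 8 * max |A| 1 ^ 2 * ((j : ℝ) + 1) * m ≤ Real.exp (-4) * Real.log p)
    (hii : 4 * ((j : ℝ) + 1) ^ 3 * Real.log p ^ 2 * (4 * max |A| 1 ^ 2 * Real.exp 2 * m) ^ (j + 1) ≤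
      Real.exp (Real.log p - 4 * ((j : ℝ) + 1)))
    (hiii : 8 * ((j : ℝ) + 1) ^ 3 * Real.log p ≤ Real.exp ((j : ℝ) + 1)) :
    (padicValRat p ((((u : ℚ) / v) ^ 2) - 1) : ℝ) * Real.log p ≤
      (∏ q ∈ (u * v).primeFactors, Real.log q) * Real.log (max (Real.exp 1) (2 * y)) *
        (3 * ((p : ℝ) * Real.exp (-3 * ((j : ℝ) + 1)))) := by
  classical
  have huv0 : u * v ≠ 0 := Nat.mul_ne_zero hu.ne' hv.ne'
  obtain ⟨q₁, hq₁⟩ : (u * v).primeFactors.Nonempty :=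
    Nat.nonempty_primeFactors.mpr h1
  have hraw := inflated_bound hYu hu hv huv hq₁ hp hp5 hpuv hP hm hPm
  rw [hPj] at hraw
  set n := (u * v).primeFactors.card with hndef
  set L := Real.log p with hLdef
  set Ab := max |A| 1 with hAb
  set Luv := ∏ q ∈ (u * v).primeFactors, Real.log (q : ℝ) with hLuv
  set Sν := ∑ q ∈ (u * v).primeFactors, ((u * v).factorization q : ℝ) with hSν
  set Y := Real.log (max (Real.exp 1) (2 * y)) with hYdef
  have hp0 : (0 : ℝ) < p := by exact_mod_cast hp.pos
  have hexpL : Real.exp L = p := by rw [hLdef, Real.exp_log hp0]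
  have hAb1 : 1 ≤ Ab := le_max_right _ _
  have hn1 : 1 ≤ n := Finset.card_pos.mpr ⟨q₁, hq₁⟩
  have hLuv0 : 0 ≤ Luv := Finset.prod_nonneg fun q hq =>
    Real.log_nonneg (by exact_mod_cast (Nat.prime_of_mem_primeFactors hq).one_lt.le)
  have hY1 : 1 ≤ Y := one_le_log_max_exp _
  -- the exponent factor
  have hSν0 : 0 ≤ Sν := Finset.sum_nonneg fun q _ => Nat.cast_nonneg _
  have hSν : Sν * Real.log 2 ≤ 2 * y :=
    (sum_factorization_mul_log_two_le (u * v) huv0).trans huvy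
  have hM := max_log_le (n := n) (j := j) hy hSν0 hSν (by omega)
  -- the numeric core
  have hcore := numeric_core (A := Ab) (m := m) (L := L) (j := j) (n := n) hAb1 hm hj hn1 hn hkL
    hi hii hiii
  rw [hexpL] at hcore
  -- assemble: raw bound × log p, then the two estimates
  have hT0 : 0 ≤ (p : ℝ) * (((n + j : ℕ) : ℝ) / L) ^ (n + j) + Real.exp ((n + j : ℕ) : ℝ) * L := by
    have : 0 ≤ L := Real.log_nonneg (by exact_mod_cast hp.one_lt.le)
    positivity
  have hH0 : 0 ≤ 2 ^ n * Luv * (3 + 2 * (j : ℝ) * m) * m ^ j := by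
    have : 0 ≤ m := by linarith
    positivity
  have hL0 : 0 ≤ L := Real.log_nonneg (by exact_mod_cast hp.one_lt.le)
  have hM0 : 0 ≤ max (Real.log (2 + 2 * ((j : ℝ) + 1) * Sν)) (((n + j : ℕ) : ℝ) ^ 2) :=
    le_trans (sq_nonneg _) (le_max_right _ _)
  have hF0 : 0 ≤ Ab ^ (n + j) * ((p : ℝ) * (((n + j : ℕ) : ℝ) / L) ^ (n + j) +
      Real.exp ((n + j : ℕ) : ℝ) * L) * (2 ^ n * Luv * (3 + 2 * (j : ℝ) * m) * m ^ j) := by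
    have : 0 ≤ Ab ^ (n + j) := pow_nonneg (by linarith) _
    exact mul_nonneg (mul_nonneg this hT0) hH0
  calc (padicValRat p ((((u : ℚ) / v) ^ 2) - 1) : ℝ) * L
      ≤ (Ab ^ (n + j) * ((p : ℝ) * (((n + j : ℕ) : ℝ) / L) ^ (n + j) + Real.exp ((n + j : ℕ) : ℝ) * L) *
          (2 ^ n * Luv * (3 + 2 * (j : ℝ) * m) * m ^ j) *
          max (Real.log (2 + 2 * ((j : ℝ) + 1) * Sν)) (((n + j : ℕ) : ℝ) ^ 2)) * L := by
        apply mul_le_mul_of_nonneg_right _ hL0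
        exact hraw
    _ ≤ (Ab ^ (n + j) * ((p : ℝ) * (((n + j : ℕ) : ℝ) / L) ^ (n + j) + Real.exp ((n + j : ℕ) : ℝ) * L) *
          (2 ^ n * Luv * (3 + 2 * (j : ℝ) * m) * m ^ j) *
          (4 * ((j : ℝ) + 1) ^ 2 * Y)) * L := by
        apply mul_le_mul_of_nonneg_right _ hL0
        exact mul_le_mul_of_nonneg_left hM hF0
    _ = Luv * Y * (L * (Ab ^ (n + j) * ((p : ℝ) * (((n + j : ℕ) : ℝ) / L) ^ (n + j) +
          Real.exp ((n + j : ℕ) : ℝ) * L) * (2 ^ n * (3 + 2 * (j : ℝ) * m) * m ^ j) *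
          (4 * ((j : ℝ) + 1) ^ 2))) := by ring
    _ ≤ Luv * Y * (3 * Real.exp (-3 * ((j : ℝ) + 1)) * p) :=
        mul_le_mul_of_nonneg_left hcore (mul_nonneg hLuv0 (by linarith))
    _ = Luv * Y * (3 * ((p : ℝ) * Real.exp (-3 * ((j : ℝ) + 1)))) := by ring


/-! ### The engine at the top prime: choice of `k`, auxiliary primes, and the absorptions -/

/-- `45 ≤ e⁴`, `log 45 ≤ 4`. [folklore] -/
theorem log_fortyfive_le_four : Real.log 45 ≤ 4 := by
  have he1 : (2.7182818283 : ℝ) < Real.exp 1 := Real.exp_one_gt_d9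
  have h : Real.exp 4 = Real.exp 1 ^ 4 := by rw [← Real.exp_nat_mul]; norm_num
  have h45 : (45 : ℝ) ≤ Real.exp 4 := by
    rw [h]; nlinarith [pow_le_pow_left₀ (by norm_num : (0:ℝ) ≤ 2.7182818283) he1.le 4]
  calc Real.log 45 ≤ Real.log (Real.exp 4) := Real.log_le_log (by norm_num) h45
    _ = 4 := Real.log_exp 4

/-- **The bound at the top prime, with Stewart's parameters.** Let `Ā = max(|A|, 1)`,
`C₂ = 64 Ā² e⁴`, `L ≥ 16` with `ℓ = log L`, and let `p ∤ uv` be a prime with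
`L/4 ≤ log p ≤ L` (the top prime of the third member), where `u, v` are coprime positive with
`uv > 1`, `log(uv) ≤ 2y` and few prime factors: `ω(uv) ≤ 2 + 6 log D + L/(8 C₂ ℓ)`. Under the
largeness conditions on `L` listed as hypotheses, with `k = ⌊log p / (C₂ log log p)⌋`, `k − 1`
auxiliary primes (of logarithmic size `≤ 4ℓ`, Chebyshev) and `X = p e^{−3k}`:
`D² e^{6c₁L/ℓ} ≤ X` for `c₁ = 1/(144 C₂)`, `X ≤ p · e³ · e^{−3L/(4C₂ℓ)}`, and
`ord_p((u/v)² − 1) · log p ≤ (∏_{q∣uv} log q) · log max{e, 2y} · 3X`.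
[cite: Stewart2013, Lemma 8 and (28)–(38) (arXiv pp. 9–10)] -/
theorem top_prime_bound
    (hYu : ∀ (n p : ℕ) (α : Fin n → ℚ) (b : Fin n → ℤ), 1 ≤ n → p.Prime → 5 ≤ p →
      (∀ i, α i ≠ 0 ∧ padicValRat p (α i) = 0) → (∀ e : Fin n → ℤ, ∏ i, α i ^ e i = 1 → e = 0) →
      b ≠ 0 → (padicValRat p (∏ i, α i ^ b i - 1) : ℝ) ≤
        A ^ n * max ((p : ℝ) * ((n : ℝ) / Real.log p) ^ n) (Real.exp n * Real.log p) *
          (∏ i, max 1 (logHeight₁ (α i))) * max (Real.log (2 + ∑ i, |(b i : ℝ)|)) ((n : ℝ) ^ 2))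
    {C₂ : ℝ} (hC₂ : C₂ = 64 * max |A| 1 ^ 2 * Real.exp 4) {D : ℝ} (hD : 1 ≤ D)
    {u v : ℕ} (hu : 0 < u) (hv : 0 < v) (huv : u.Coprime v) (h1 : 1 < u * v)
    {y : ℝ} (hy : 0 ≤ y) (huvy : Real.log ((u * v : ℕ) : ℝ) ≤ 2 * y)
    {p : ℕ} (hp : p.Prime) (hpuv : ¬ p ∣ u * v)
    {L : ℝ} (hL16 : 16 ≤ L) (hLp : L / 4 ≤ Real.log p) (hpL : Real.log p ≤ L)
    (hc2 : ∀ x : ℝ, L / 4 ≤ x → 8 * C₂ * Real.log x ^ 2 ≤ x)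
    (hc3 : ∀ x : ℝ, L / 4 ≤ x → 6 + Real.log x ≤ 0.001 * x)
    (hc4 : 2 + 6 * Real.log D ≤ L / (8 * C₂ * Real.log L))
    (hn : (((u * v).primeFactors.card : ℕ) : ℝ) ≤ 2 + 6 * Real.log D + L / (8 * C₂ * Real.log L)) :
    ∃ X : ℝ, D ^ 2 * Real.exp (6 * (1 / (144 * C₂)) * L / Real.log L) ≤ X ∧
      X ≤ (p : ℝ) * Real.exp 3 * Real.exp (-(3 * L) / (4 * C₂ * Real.log L)) ∧
      (padicValRat p ((((u : ℚ) / v) ^ 2) - 1) : ℝ) * Real.log p ≤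
        (∏ q ∈ (u * v).primeFactors, Real.log q) * Real.log (max (Real.exp 1) (2 * y)) * (3 * X) := by
  classical
  -- constants
  obtain ⟨Ab, hAb⟩ : ∃ Ab : ℝ, Ab = max |A| 1 := ⟨_, rfl⟩
  rw [← hAb] at hC₂
  have hAb1 : 1 ≤ Ab := by rw [hAb]; exact le_max_right _ _
  have hAbpos : 0 < Ab := by linarith
  have he1 : (2.7182818283 : ℝ) < Real.exp 1 := Real.exp_one_gt_d9
  have he4 : (54 : ℝ) ≤ Real.exp 4 := by
    have h : Real.exp 4 = Real.exp 1 ^ 4 := by rw [← Real.exp_nat_mul]; norm_num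
    rw [h]; nlinarith [pow_le_pow_left₀ (by norm_num : (0:ℝ) ≤ 2.7182818283) he1.le 4]
  have hAb2 : 1 ≤ Ab ^ 2 := one_le_pow₀ hAb1
  have hC₂ge : 3456 ≤ C₂ := by
    rw [hC₂]
    calc (3456 : ℝ) = 64 * 1 * 54 := by norm_num
      _ ≤ 64 * Ab ^ 2 * Real.exp 4 := mul_le_mul (mul_le_mul_of_nonneg_left hAb2 (by norm_num)) he4
          (by norm_num) (by positivity)
  have hC₂pos : 0 < C₂ := by linarith
  -- logarithms
  obtain ⟨Ls, hLs⟩ : ∃ Ls : ℝ, Ls = Real.log p := ⟨_, rfl⟩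
  obtain ⟨ℓ, hℓ⟩ : ∃ ℓ : ℝ, ℓ = Real.log L := ⟨_, rfl⟩
  rw [← hLs] at hLp hpL
  rw [← hℓ] at hc4 hn
  have hp0 : (0 : ℝ) < p := by exact_mod_cast hp.pos
  have hexpLs : Real.exp Ls = p := by rw [hLs, Real.exp_log hp0]
  have hLpos : 0 < L := by linarith
  have hLs4 : 4 ≤ Ls := by linarith
  have hLspos : 0 < Ls := by linarith
  have hlog2 : (0.6931471803 : ℝ) < Real.log 2 := Real.log_two_gt_d9
  have hlog2' : Real.log 2 < 0.6931471808 := Real.log_two_lt_d9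
  have hlog4eq : Real.log 4 = 2 * Real.log 2 := by
    rw [show (4 : ℝ) = 2 ^ 2 by norm_num, Real.log_pow]; push_cast; ring
  have hlog16eq : Real.log 16 = 4 * Real.log 2 := by
    rw [show (16 : ℝ) = 2 ^ 4 by norm_num, Real.log_pow]; push_cast; ring
  have hℓ16 : Real.log 16 ≤ ℓ := by rw [hℓ]; exact Real.log_le_log (by norm_num) hL16
  have hℓ276 : 2.76 ≤ ℓ := by rw [hlog16eq] at hℓ16; linarith
  have hℓpos : 0 < ℓ := by linarith
  have hlogLs1 : Real.log 4 ≤ Real.log Ls := Real.log_le_log (by norm_num) hLs4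
  have hlogLs1' : 1 ≤ Real.log Ls := by rw [hlog4eq] at hlogLs1; linarith
  have hlogLspos : 0 < Real.log Ls := by linarith
  have hlogLsℓ : Real.log Ls ≤ ℓ := by rw [hℓ]; exact Real.log_le_log hLspos hpL
  have hlogLsℓ4 : ℓ - 2 * Real.log 2 ≤ Real.log Ls := by
    have h1 : Real.log (L / 4) ≤ Real.log Ls := Real.log_le_log (by positivity) hLp
    rw [Real.log_div hLpos.ne' (by norm_num), hlog4eq, ← hℓ] at h1
    exact h1
  have hlogLshalf : ℓ / 2 ≤ Real.log Ls := by linarith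
  -- `p ≥ 5`
  have hp5 : 5 ≤ p := by
    by_contra hlt
    push Not at hlt
    have : (p : ℝ) ≤ 4 := by exact_mod_cast Nat.lt_succ_iff.mp hlt
    have h' : Ls ≤ Real.log 4 := by rw [hLs]; exact Real.log_le_log hp0 this
    rw [hlog4eq] at h'; linarith
  -- the parameter `x = Ls / (C₂ log Ls)` and `k = ⌊x⌋`
  obtain ⟨x, hx⟩ : ∃ x : ℝ, x = Ls / (C₂ * Real.log Ls) := ⟨_, rfl⟩
  have hxpos : 0 < x := by rw [hx]; positivity
  have hxlow : L / (4 * C₂ * ℓ) ≤ x := by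
    rw [hx, div_le_div_iff₀ (by positivity) (by positivity)]
    calc L * (C₂ * Real.log Ls) ≤ L * (C₂ * ℓ) := by
          apply mul_le_mul_of_nonneg_left _ hLpos.le
          exact mul_le_mul_of_nonneg_left hlogLsℓ hC₂pos.le
      _ ≤ (4 * Ls) * (C₂ * ℓ) :=
          mul_le_mul_of_nonneg_right (by linarith only [hLp]) (mul_pos hC₂pos hℓpos).le
      _ = Ls * (4 * C₂ * ℓ) := by ring
  have hxup : x ≤ Ls / C₂ := by
    rw [hx]; apply div_le_div_of_nonneg_left hLspos.le hC₂pos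
    exact le_mul_of_one_le_right hC₂pos.le hlogLs1'
  have hxLs8 : x ≤ Ls / 32 := by
    have : Ls / C₂ ≤ Ls / 32 := div_le_div_of_nonneg_left hLspos.le (by norm_num) (by linarith)
    linarith
  have hL8 : L / (8 * C₂ * ℓ) = (L / (4 * C₂ * ℓ)) / 2 := by field_simp; ring
  have hx6 : 2 * (2 + 6 * Real.log D) ≤ x := by rw [hL8] at hc4; linarith
  have hlogD0 : 0 ≤ Real.log D := Real.log_nonneg hD
  have hx4 : 4 ≤ x := by linarith
  obtain ⟨k, hk⟩ : ∃ k : ℕ, k = ⌊x⌋₊ := ⟨_, rfl⟩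
  have hkx : (k : ℝ) ≤ x := by rw [hk]; exact Nat.floor_le hxpos.le
  have hxk : x < k + 1 := by rw [hk]; exact Nat.lt_floor_add_one x
  have hk2 : 2 ≤ k := by rw [hk]; exact Nat.le_floor (by push_cast; linarith)
  clear hk
  have hk1 : 1 ≤ k := by omega
  have hkLs : (k : ℝ) ≤ Ls := hkx.trans (hxup.trans (div_le_self hLspos.le (by linarith)))
  -- `n ≤ k`
  obtain ⟨n, hndef⟩ : ∃ n : ℕ, n = (u * v).primeFactors.card := ⟨_, rfl⟩
  rw [← hndef] at hn
  have huv0 : u * v ≠ 0 := Nat.mul_ne_zero hu.ne' hv.ne'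
  have hnx : (n : ℝ) ≤ x := by
    have : 2 + 6 * Real.log D + L / (8 * C₂ * ℓ) ≤ L / (4 * C₂ * ℓ) := by rw [hL8] at hc4 ⊢; linarith
    exact hn.trans (this.trans hxlow)
  have hnk : n ≤ k := by
    have : (n : ℝ) < k + 1 := lt_of_le_of_lt hnx hxk
    exact_mod_cast Nat.lt_succ_iff.mp (by exact_mod_cast this)
  obtain ⟨j, hj⟩ : ∃ j : ℕ, j = k - 1 := ⟨_, rfl⟩
  have hjk : j + 1 = k := by omega
  have hj1 : 1 ≤ j := by omega
  have hjr : ((j : ℝ) + 1) = k := by exact_mod_cast hjk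
  obtain ⟨m, hm⟩ : ∃ m : ℝ, m = 4 * ℓ := ⟨_, rfl⟩
  have hm1 : 1 ≤ m := by rw [hm]; linarith
  -- the absorptions of `numeric_core` for these parameters
  obtain ⟨hi, hkL, hiii, hii, h3k⟩ := stewart_param_bounds hAb1 hC₂ hL16 hLp hpL hℓ hx hkx hxk hk2 hm
    (hc2 Ls hLp) (hc3 Ls hLp)
  rw [← hjr] at hi hkL hiii hii
  rw [← hjk] at hii
  -- auxiliary primes
  obtain ⟨Bad, hBad⟩ : ∃ Bad : Finset ℕ, Bad = insert p (u * v).primeFactors := ⟨_, rfl⟩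
  have hBadcard : Bad.card ≤ n + 1 := by
    rw [hBad, hndef]; exact Finset.card_insert_le _ _
  obtain ⟨P, hPcard, hPprop⟩ := exists_auxPrimes_le k n hk2 Bad hBadcard
  have hP : ∀ r ∈ P, r.Prime ∧ ¬ r ∣ u * v ∧ r ≠ p := by
    intro r hr
    obtain ⟨hrp, hrB, -⟩ := hPprop r hr
    refine ⟨hrp, fun hdvd => hrB ?_, fun hrp' => hrB ?_⟩
    · rw [hBad]; exact Finset.mem_insert_of_mem (Nat.mem_primeFactors.mpr ⟨hrp, hdvd, huv0⟩)
    · rw [hBad, hrp']; exact Finset.mem_insert_self _ _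
  have hPj : P.card = j := by rw [hj]; exact hPcard
  -- size of the auxiliary primes: `r ≤ 45 (k+n) log(k+n) ≤ 45 Ls log Ls`, so `log r ≤ 4ℓ`
  have hkn2 : 2 ≤ k + n := by omega
  have hknLs : ((k + n : ℕ) : ℝ) ≤ Ls := by
    push_cast
    have : (n : ℝ) ≤ k := by exact_mod_cast hnk
    have h2x : 2 * x ≤ Ls := by linarith [hxLs8]
    linarith
  have hkn0 : (0 : ℝ) < ((k + n : ℕ) : ℝ) := by exact_mod_cast (show 0 < k + n by omega)
  have hPm : ∀ r ∈ P, Real.log r ≤ m := by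
    intro r hr
    have hrp := (hPprop r hr).1
    have hr0 : (0 : ℝ) < r := by exact_mod_cast hrp.pos
    have hrle := (hPprop r hr).2.2
    have hlogkn : Real.log ((k + n : ℕ) : ℝ) ≤ Real.log Ls := Real.log_le_log hkn0 hknLs
    have hlogkn0 : 0 ≤ Real.log ((k + n : ℕ) : ℝ) := Real.log_nonneg (by exact_mod_cast (show 1 ≤ k + n by omega))
    have h45 : (r : ℝ) ≤ 45 * Ls * Real.log Ls := by
      calc (r : ℝ) ≤ 45 * ((k + n : ℕ) : ℝ) * Real.log ((k + n : ℕ) : ℝ) := hrle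
        _ ≤ 45 * Ls * Real.log Ls := by
            apply mul_le_mul (mul_le_mul_of_nonneg_left hknLs (by norm_num)) hlogkn hlogkn0
            positivity
    have hlogℓ : Real.log ℓ ≤ ℓ - 1 := by
      have := Real.log_le_sub_one_of_pos hℓpos; linarith
    have hloglogLs : Real.log (Real.log Ls) ≤ Real.log ℓ := Real.log_le_log hlogLspos hlogLsℓ
    calc Real.log r ≤ Real.log (45 * Ls * Real.log Ls) := Real.log_le_log hr0 h45
      _ = Real.log 45 + Real.log Ls + Real.log (Real.log Ls) := by
          rw [Real.log_mul (by positivity) hlogLspos.ne', Real.log_mul (by norm_num) hLspos.ne']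
      _ ≤ 4 + ℓ + (ℓ - 1) := by linarith [log_fortyfive_le_four]
      _ ≤ m := by rw [hm]; linarith
  -- the inflation bound at `p`
  have hnj : (u * v).primeFactors.card ≤ j + 2 := by rw [← hndef]; omega
  rw [hLs] at hkL hi hii hiii
  rw [hAb] at hi hii
  have hinf := inflation_at_top hYu hu hv huv h1 hy huvy hp hp5 hpuv hP hPj hj1 hm1 hPm hnj hkL
    hi hii hiii
  -- the quantity `X = p e^{-3k}`
  refine ⟨(p : ℝ) * Real.exp (-3 * ((j : ℝ) + 1)), ?_, ?_, hinf⟩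
  · -- `D² e^{6 c₁ L/ℓ} ≤ p e^{-3k}`: compare exponents
    rw [← hℓ, hjr, ← hexpLs, ← Real.exp_add]
    have hD0 : 0 < D := by linarith
    have hD2 : D ^ 2 = Real.exp (2 * Real.log D) := by
      rw [show (2 : ℝ) * Real.log D = ((2 : ℕ) : ℝ) * Real.log D by norm_num, Real.exp_nat_mul,
        Real.exp_log hD0]
    rw [hD2, ← Real.exp_add, Real.exp_le_exp]
    have hc₁ : 6 * (1 / (144 * C₂)) * L / ℓ ≤ Ls / 8 := by
      have hℓ1 : 1 ≤ ℓ := by linarith only [hℓ276]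
      have hrw : 6 * (1 / (144 * C₂)) * L / ℓ = L / (24 * C₂ * ℓ) := by field_simp; ring
      rw [hrw, div_le_div_iff₀ (by positivity) (by norm_num)]
      -- `8 L ≤ 24 C₂ ℓ Ls` since `L ≤ 4 Ls`, `C₂ ≥ 1`, `ℓ ≥ 1`
      have h1' : L * 8 ≤ (4 * Ls) * 8 := by linarith only [hLp]
      have h2' : (4 * Ls) * 8 ≤ Ls * (24 * C₂ * ℓ) := by
        have : (32 : ℝ) ≤ 24 * C₂ * ℓ := by
          calc (32 : ℝ) ≤ 24 * 3456 * 1 := by norm_num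
            _ ≤ 24 * C₂ * ℓ := mul_le_mul (mul_le_mul_of_nonneg_left hC₂ge (by norm_num)) hℓ1
                (by norm_num) (by positivity)
        calc (4 * Ls) * 8 = Ls * 32 := by ring
          _ ≤ Ls * (24 * C₂ * ℓ) := mul_le_mul_of_nonneg_left this hLspos.le
      linarith only [h1', h2']
    have hlogD : 2 * Real.log D ≤ Ls / 2 := by linarith
    linarith
  · -- `p e^{-3k} ≤ p e³ e^{-3L/(4C₂ℓ)}`
    rw [← hℓ, hjr, mul_assoc]
    apply mul_le_mul_of_nonneg_left _ hp0.le
    rw [← Real.exp_add, Real.exp_le_exp]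
    have : -(3 * L) / (4 * C₂ * ℓ) = -3 * (L / (4 * C₂ * ℓ)) := by ring
    rw [this]
    linarith

end Top

end Summit.ABC.ABC.Theorems.SubPowerSY

end
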